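import Literature.Probability.Percolation.SitePercolationMeasure
import Literature.Probability.Percolation.SiteConnectionTools
import Literature.Probability.Percolation.CerfTwoArms
import Literature.Probability.Percolation.CerfLem71Proofs
import HarnessLib

/-!
# Cerf 2015, Corollary 7.2 (two-arms for a box): proof

Topic `Literature/Probability/Percolation`. Sorry-free discharge of the named fact
`Literature.Probability.Percolation.Cerf2015_cor_7_2` (`CerfTwoArms.lean`) from Lemma 7.1
(`Cerf2015_lem_7_1_holds`, `CerfLem71Proofs.lean`). R. Cerf, *A lower bound on the two-arms
exponent for critical percolation on the lattice*, Ann. Probab. 43 (2015) 2458–2480,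
arXiv:1306.3105, §7 (p. 12 of the 16-page arXiv rendering).

## The argument (Cor. 7.2, p. 12), as formalised

`two-arms(Λ(n), ℓ) = ⋃_{a, b ∈ ∂ⁱⁿΛ(n)} two-arms(Λ(n), a, b, ℓ)` (`siteTwoArmsBox_subset_biUnion`:
the two clusters start in `Λ(n)` and reach `∂ⁱⁿΛ(n+ℓ)`, so by the exit lemma they pass through
sites `a', b' ∈ ∂ⁱⁿΛ(n)`, whose clusters they are). The union bound, Lemma 7.1 with `k = n`
(`P(two-arms(Λ(n),a,b,ℓ)) · q ≤ P(·) · P(a ⟷ b in Λ(2n)) ≤ C₇ (2n)^{2d} P(two-arms(0, ℓ−n−1))`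
for any lower bound `q` of the connection probabilities) and
`|∂ⁱⁿΛ(n)|² (2n)^{2d} ≤ (2d)² (2n+1)^{2d−2} (2n)^{2d} ≤ 4d² 9^{d−1} 4^d · n^{4d−2}` give the claim
with `C = 4d² 9^{d−1} 4^d max(C₇, 0)`.

## Main results

* `siteTwoArmsBox_subset_biUnion`: reduction of the box event to boundary pairs;
* `Cerf2015_cor_7_2_of_lem_7_1 : Cerf2015_lem_7_1 → Cerf2015_cor_7_2`;
* `Cerf2015_cor_7_2_holds : Cerf2015_cor_7_2`.

## References

* R. Cerf, Ann. Probab. 43 (2015) 2458–2480, arXiv:1306.3105, Cor. 7.2 (p. 12).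
-/

noncomputable section

open MeasureTheory Literature.Probability.LatticeModels Literature.Probability.Percolation
open scoped Finset

namespace Literature.Probability.Percolation

section CritPerc

variable {V : Type*} {d : ℕ}

/-- Two sites of the same restricted cluster have the same restricted cluster. [folklore] -/
theorem siteClusterIn_eq_of_mem {G : SimpleGraph V} {S : Set V} {ω : SiteConfig V} {x y : V}
    (hy : y ∈ siteClusterIn G S ω x) : siteClusterIn G S ω y = siteClusterIn G S ω x := by
  ext z
  constructor
  · intro hz
    exact mem_siteClusterIn_of_siteConnIn hy hz
  · intro hz
    exact siteConnIn_of_mem_siteClusterIn hy hz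

/-- **`two-arms(Λ(n), ℓ)` is a union over boundary pairs** (Cerf 2015, proof of Cor. 7.2, p. 12:
"`two-arms(Λ(n), ℓ) = ⋃_{a,b ∈ ∂ⁱⁿΛ(n)} two-arms(Λ(n), a, b, ℓ)`"): for `ℓ ≥ 1`, if the clusters
of `a, b ∈ Λ(n)` in `Λ(n+ℓ)` are disjoint and reach `∂ⁱⁿΛ(n+ℓ)`, then so are the (same) clusters
of suitable `a', b' ∈ ∂ⁱⁿΛ(n)`. [cite: Cerf2015, Cor 7.2 (proof)] -/
theorem siteTwoArmsBox_subset_biUnion (n ℓ : ℕ) :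
    siteTwoArmsBox d n ℓ ⊆ ⋃ ab ∈ innerBoundary (zdGraph d) (box d n) ×ˢ
        innerBoundary (zdGraph d) (box d n), siteTwoArmsPair d n ab.1 ab.2 ℓ := by
  intro ω hω
  obtain ⟨a, ha, b, hb, hdisj, ⟨wa, hwa, hwac⟩, ⟨wb, hwb, hwbc⟩⟩ := hω
  have hsub : box d n ⊆ box d (n + ℓ) := box_mono d (Nat.le_add_right n ℓ)
  obtain ⟨a', ha', ha'c⟩ := exists_innerBoundary_siteConnIn_of_subset hsub ha hwa hwac
  obtain ⟨b', hb', hb'c⟩ := exists_innerBoundary_siteConnIn_of_subset hsub hb hwb hwbc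
  have ha'C : a' ∈ siteClusterIn (zdGraph d) ↑(box d (n + ℓ)) ω a :=
    siteConnIn_mono (zdGraph d) (Finset.coe_subset.2 hsub) a a' ha'c
  have hb'C : b' ∈ siteClusterIn (zdGraph d) ↑(box d (n + ℓ)) ω b :=
    siteConnIn_mono (zdGraph d) (Finset.coe_subset.2 hsub) b b' hb'c
  simp only [Set.mem_iUnion, Finset.mem_product, exists_prop, Prod.exists]
  refine ⟨a', b', ⟨ha', hb'⟩, ?_⟩
  refine ⟨?_, ⟨wa, hwa, ?_⟩, ⟨wb, hwb, ?_⟩⟩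
  · rw [siteClusterIn_eq_of_mem ha'C, siteClusterIn_eq_of_mem hb'C]; exact hdisj
  · rw [siteClusterIn_eq_of_mem ha'C]; exact hwac
  · rw [siteClusterIn_eq_of_mem hb'C]; exact hwbc

/-- **Cerf 2015, Corollary 7.2 from Lemma 7.1** (p. 12): union bound over boundary pairs, Lemma
7.1 with `k = n`, and the count `|∂ⁱⁿΛ(n)|² (2n)^{2d} ≤ 4d² 9^{d−1} 4^d n^{4d−2}`; see the module
docstring. [cite: Cerf2015, Cor 7.2] -/
theorem Cerf2015_cor_7_2_of_lem_7_1 (h71 : Cerf2015_lem_7_1) : Cerf2015_cor_7_2 := by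
  intro d hd p hp0 hp1
  obtain ⟨C₇, hC₇⟩ := h71 d hd p hp0 hp1
  set C₇' : ℝ := max C₇ 0 with hC₇'
  have hC₇'0 : 0 ≤ C₇' := le_max_right _ _
  set C : ℝ := 4 * (d : ℝ) ^ 2 * 9 ^ (d - 1) * 4 ^ d * C₇' with hC
  have hC0 : 0 ≤ C := by positivity
  refine ⟨C, fun n hn ℓ hℓ q hq => ?_⟩
  set P := sitePercolation (Site d) p with hP
  set T := P.real (siteTwoArms d 0 (ℓ - n - 1)) with hT
  have hT0 : 0 ≤ T := measureReal_nonneg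
  have hn0 : (0 : ℝ) < n := by exact_mod_cast (show 0 < n by omega)
  -- Lemma 7.1 with `k = n`, for boundary pairs, against the lower bound `q`
  have hpair : ∀ a ∈ innerBoundary (zdGraph d) (box d n),
      ∀ b ∈ innerBoundary (zdGraph d) (box d n),
      P.real (siteTwoArmsPair d n a b ℓ) * q ≤ C₇' * (2 * (n : ℝ)) ^ (2 * d) * T := by
    intro a ha b hb
    have haB : a ∈ box d n := (mem_innerBoundary_iff.1 ha).1
    have hbB : b ∈ box d n := (mem_innerBoundary_iff.1 hb).1
    have h1 := hC₇ n hn n ℓ (by omega) a haB b hbB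
    have h2 : (n : ℝ) + n = 2 * n := by ring
    rw [h2, show n + n = 2 * n by ring] at h1
    have h3 : P.real (siteTwoArmsPair d n a b ℓ) * q ≤
        P.real (siteTwoArmsPair d n a b ℓ) *
          P.real (siteConnIn (zdGraph d) ↑(box d (2 * n)) a b) :=
      mul_le_mul_of_nonneg_left (hq a ha b hb) measureReal_nonneg
    have h4 : C₇ * (2 * (n : ℝ)) ^ (2 * d) * T ≤ C₇' * (2 * (n : ℝ)) ^ (2 * d) * T := by
      gcongr; exact le_max_left _ _
    exact h3.trans (h1.trans h4)
  -- union bound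
  set I := innerBoundary (zdGraph d) (box d n) with hI
  have hunion : P.real (siteTwoArmsBox d n ℓ) ≤
      ∑ ab ∈ I ×ˢ I, P.real (siteTwoArmsPair d n ab.1 ab.2 ℓ) :=
    (measureReal_mono (siteTwoArmsBox_subset_biUnion n ℓ) (measure_ne_top _ _)).trans
      (measureReal_biUnion_finset_le _ _)
  -- the case `q ≤ 0` is trivial
  rcases le_or_gt q 0 with hq0 | hq0
  · have h1 : P.real (siteTwoArmsBox d n ℓ) * q ≤ 0 :=
      mul_nonpos_of_nonneg_of_nonpos measureReal_nonneg hq0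
    have h2 : 0 ≤ C * (n : ℝ) ^ (4 * d - 2) * T := by positivity
    exact h1.trans h2
  -- summing Lemma 7.1 over the `|∂ⁱⁿΛ(n)|²` pairs
  have hsum : P.real (siteTwoArmsBox d n ℓ) * q ≤
      (#I : ℝ) ^ 2 * (C₇' * (2 * (n : ℝ)) ^ (2 * d) * T) := by
    calc P.real (siteTwoArmsBox d n ℓ) * q
        ≤ (∑ ab ∈ I ×ˢ I, P.real (siteTwoArmsPair d n ab.1 ab.2 ℓ)) * q :=
          mul_le_mul_of_nonneg_right hunion hq0.le
      _ = ∑ ab ∈ I ×ˢ I, P.real (siteTwoArmsPair d n ab.1 ab.2 ℓ) * q := Finset.sum_mul _ _ _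
      _ ≤ ∑ ab ∈ I ×ˢ I, C₇' * (2 * (n : ℝ)) ^ (2 * d) * T := by
          apply Finset.sum_le_sum
          rintro ⟨a, b⟩ hab
          rw [Finset.mem_product] at hab
          exact hpair a hab.1 b hab.2
      _ = (#I : ℝ) ^ 2 * (C₇' * (2 * (n : ℝ)) ^ (2 * d) * T) := by
          rw [Finset.sum_const, Finset.card_product, nsmul_eq_mul]; push_cast; ring
  -- counting
  have hcard : (#I : ℝ) ≤ 2 * d * (2 * n + 1) ^ (d - 1) := by
    have := card_innerBoundary_box_le (d := d) n
    exact_mod_cast this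
  have h31 : (2 * (n : ℝ) + 1) ≤ 3 * n := by
    have : (1 : ℝ) ≤ n := by exact_mod_cast hn
    linarith
  have hcard2 : (#I : ℝ) ^ 2 ≤ 4 * (d : ℝ) ^ 2 * 9 ^ (d - 1) * (n : ℝ) ^ (2 * (d - 1)) := by
    calc (#I : ℝ) ^ 2 ≤ (2 * (d : ℝ) * (2 * (n : ℝ) + 1) ^ (d - 1)) ^ 2 := by gcongr
      _ ≤ (2 * (d : ℝ) * (3 * (n : ℝ)) ^ (d - 1)) ^ 2 := by gcongr
      _ = 4 * (d : ℝ) ^ 2 * 9 ^ (d - 1) * (n : ℝ) ^ (2 * (d - 1)) := by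
          rw [show (9 : ℝ) = 3 ^ 2 by norm_num, ← pow_mul, pow_mul (n : ℝ) 2 (d - 1)]
          ring
  have hpow : (n : ℝ) ^ (2 * (d - 1)) * (2 * (n : ℝ)) ^ (2 * d) =
      4 ^ d * (n : ℝ) ^ (4 * d - 2) := by
    rw [mul_pow, show (2 : ℝ) ^ (2 * d) = 4 ^ d by rw [pow_mul]; norm_num,
      show 4 * d - 2 = 2 * (d - 1) + 2 * d by omega, pow_add]
    ring
  calc P.real (siteTwoArmsBox d n ℓ) * q
      ≤ (#I : ℝ) ^ 2 * (C₇' * (2 * (n : ℝ)) ^ (2 * d) * T) := hsum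
    _ ≤ (4 * (d : ℝ) ^ 2 * 9 ^ (d - 1) * (n : ℝ) ^ (2 * (d - 1))) *
          (C₇' * (2 * (n : ℝ)) ^ (2 * d) * T) := by gcongr
    _ = 4 * (d : ℝ) ^ 2 * 9 ^ (d - 1) * C₇' * ((n : ℝ) ^ (2 * (d - 1)) * (2 * (n : ℝ)) ^ (2 * d)) * T := by
          ring
    _ = C * (n : ℝ) ^ (4 * d - 2) * T := by rw [hpow, hC]; ring

/-- **Cerf 2015, Corollary 7.2, discharged.** [cite: Cerf2015, Cor 7.2] -/
theorem Cerf2015_cor_7_2_holds : Cerf2015_cor_7_2 :=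
  Cerf2015_cor_7_2_of_lem_7_1 Cerf2015_lem_7_1_holds

end CritPerc

end Literature.Probability.Percolation
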